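import Mathlib
import Summits.Ventures.PercRepro2.A3CutSplit
import Summits.Ventures.PercRepro2.A3MarkSelf

/-!
# The pendant-part expansion of (MEANS-a₃) and the cut-vertex closure of (FM)
(blind cell PercRepro2, night-1 g32; proofs/NIGHT1-G32.md §5)

Let `x` be a cut vertex with the four marks `o, a₁, a₂, b` in `VB ∪ {x}` and `v` on the mark-free
`A`-side, `c = P(v ↔ x)` (decided by the `A`-side), `D_v = P(PD_v) = (1 − c) P(Q) + c D_x`
(`prob_PD_cut`) and `s = (1 − c) P(Q) / D_v`.  With the six sums of A3CutSplit and the centrings moved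
by the affine lemmas of A3PendantFree, exactly as at a leaf of weight `c`:

  **`btw_cut`**: `btw(v) = c · ((1 − s) · btw(x) + s · FMfun(x))`      (`D_v ≠ 0`)
  **`FMfun_cut`**: `FMfun(v) = c · FMfun(x)`                          (`P(Q) ≠ 0`)

— g31's leaf expansion `btw_leaf_free` with the leaf weight replaced by the connection probability of
the part, and the cut-vertex closure of (FM).  Consequences: `A3Between_cut_of` ((MEANS-a₃)(x) ∧ (FM)(x)
⟹ (MEANS-a₃)(v): the whole pendant part reduces to its cut vertex), `FM_cut_of` ((FM)(x) ⟹ (FM)(v)),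
`HCov_cut_of`; with (MEANS-a₃) and (FM) at every mark (A3MarkSelf, A3PendantFreeMarks/Root):
**`A3Between_pendantPart_mark`** — (MEANS-a₃), hence (HCOV), holds at EVERY vertex of a mark-free part
hanging at a cut vertex that is itself a mark.  Exact check before the proof:
mining/night-1/g32/check_cut_expand.py, 190 random instances, 0 mismatches.  Standard axioms.
-/

namespace Summit.Ventures.PercRepro2

open UnionCluster CovForm CutV

namespace CovForm

namespace A3Fibre

/-! ## The expansion -/

section Expand

variable {V : Type*} {E : Type*} [Fintype V] [DecidableEq V] [Fintype E] [DecidableEq E]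
  {R : Type*} [Field R] [LinearOrder R] [IsStrictOrderedRing R] {ends : E → Sym2 V} {x : V}
  {VA VB : Finset V} {EA EB : Set E} [DecidablePred (· ∈ EA)] [DecidablePred (· ∈ EB)] {p : E → R}
  {o a₁ a₂ b v : V}

/-- **The pendant-part expansion of (MEANS-a₃)**: for `v` behind the cut vertex `x` (marks on the other
side), `c = P(v ↔ x)`, `D_v = P(PD_v) ≠ 0`, `s = (1 − c) P(Q) / D_v`,

  `btw(v) = c · ((1 − s) · btw(x) + s · FMfun(x))`. -/
theorem btw_cut (hp : IsProbVec p) (h : IsCut ends x ↑VA ↑VB EA EB) (ho : o ∈ insert x VB)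
    (h1 : a₁ ∈ insert x VB) (h2 : a₂ ∈ insert x VB) (hb : b ∈ insert x VB) (hv : v ∈ VA) (hD : prob p (PDEvent ends a₁ a₂ v) ≠ 0) :
    btw p ends o a₁ a₂ v b =
      prob p (connEvent ends v x) *
        ((1 - (1 - prob p (connEvent ends v x)) * prob p (avoidAll ends a₂ {a₁}) /
            prob p (PDEvent ends a₁ a₂ v)) * btw p ends o a₁ a₂ x b +
          (1 - prob p (connEvent ends v x)) * prob p (avoidAll ends a₂ {a₁}) /
            prob p (PDEvent ends a₁ a₂ v) * FMfun p ends o a₁ a₂ x b) := by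
  have hQpos : prob p (avoidAll ends a₂ {a₁}) ≠ 0 := by
    intro h0
    apply hD
    exact le_antisymm (h0 ▸ prob_PD_le_Q hp ends a₁ a₂ v) (prob_nonneg hp _)
  have hDsplit := prob_PD_cut (p := p) h ho h1 h2 hb hv
  have hDo : Do p ends o a₁ a₂ v =
      prob p (connEvent ends v x) * ∑ W ∈ fibresA a₁ a₂, Su p ends a₁ a₂ x o W +
        (1 - prob p (connEvent ends v x)) *
          (prob p (avoidAll ends a₂ {a₁} ∩ connEvent ends a₁ o) +
            prob p (avoidAll ends a₂ {a₁} ∩ connEvent ends a₂ o)) := by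
    rw [Do_eq_fibresA, sum_SuA_cut h ho h1 h2 hb hv (Or.inr rfl)]
  have hγ : gamma p ends o a₁ a₂ v =
      (prob p (connEvent ends v x) * ∑ W ∈ fibresA a₁ a₂, Su p ends a₁ a₂ x o W +
        (1 - prob p (connEvent ends v x)) *
          (prob p (avoidAll ends a₂ {a₁} ∩ connEvent ends a₁ o) +
            prob p (avoidAll ends a₂ {a₁} ∩ connEvent ends a₂ o))) /
      (prob p (connEvent ends v x) * prob p (PDEvent ends a₁ a₂ x) +
        (1 - prob p (connEvent ends v x)) * prob p (avoidAll ends a₂ {a₁})) := by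
    unfold gamma
    rw [hDo, hDsplit]
  have hA : ∑ W : Finset V, Ssig p ends a₁ a₂ x b W =
      prob p (avoidAll ends a₂ {a₁} ∩ connEvent ends a₁ b) -
        prob p (avoidAll ends a₂ {a₁} ∩ connEvent ends a₂ b) := by
    rw [← EQo_eq p ends b a₁ a₂ x]
    rfl
  rw [← RootEdge.btwg_gamma p ends o a₁ a₂ x b, ← RootEdge.btwg_gamma p ends o a₁ a₂ v b]
  unfold RootEdge.btwg FMfun gamma0
  rw [sum_term_cut h ho h1 h2 hb hv, sum_Ssig_cut h ho h1 h2 hb hv, sum_SFg_cut h ho h1 h2 hb hv,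
    sum_termA_cut h ho h1 h2 hb hv, sum_SuA_cut h ho h1 h2 hb hv (Or.inl rfl),
    sum_SuA_cut h ho h1 h2 hb hv (Or.inr rfl)]
  -- the centrings: everything affine in `γ`
  rw [sum_term_SFg_affine hp ends o a₁ a₂ x b (gamma p ends o a₁ a₂ v),
    sum_SFg_affine p ends o a₁ a₂ x (gamma p ends o a₁ a₂ v),
    sum_term_SFg_affine hp ends o a₁ a₂ x b (gamma p ends o a₁ a₂ x),
    sum_SFg_affine p ends o a₁ a₂ x (gamma p ends o a₁ a₂ x),
    sum_term_SFg_affine hp ends o a₁ a₂ x b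
      (LeafStep.mU p ends a₁ a₂ o / prob p (avoidAll ends a₂ {a₁})),
    sum_SFg_affine p ends o a₁ a₂ x (LeafStep.mU p ends a₁ a₂ o / prob p (avoidAll ends a₂ {a₁}))]
  rw [hγ, hA]
  unfold gamma
  rw [Do_eq_fibresA p ends o a₁ a₂ x, hDsplit]
  unfold LeafStep.mU
  rw [hDsplit] at hD
  have hnb0 := sum_Su_fibresA_eq_zero_of_PD_eq_zero hp ends a₁ a₂ x b
  have hno0 := sum_Su_fibresA_eq_zero_of_PD_eq_zero hp ends a₁ a₂ x o
  set P0 := ∑ W : Finset V, Ssig p ends a₁ a₂ x b W * RootEdge.SFg p ends o a₁ a₂ x 0 W /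
    mW p ends a₁ a₂ x W with hP0
  set Lb := ∑ W : Finset V, (s3 a₁ a₂ W : R) * Ssig p ends a₁ a₂ x b W with hLb
  set F0 := ∑ W : Finset V, RootEdge.SFg p ends o a₁ a₂ x 0 W with hF0
  set Lm := ∑ W : Finset V, (s3 a₁ a₂ W : R) * mW p ends a₁ a₂ x W with hLm
  set SA := ∑ W ∈ fibresA a₁ a₂, Su p ends a₁ a₂ x b W * Su p ends a₁ a₂ x o W / mW p ends a₁ a₂ x W
    with hSA
  set nb := ∑ W ∈ fibresA a₁ a₂, Su p ends a₁ a₂ x b W with hnb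
  set no := ∑ W ∈ fibresA a₁ a₂, Su p ends a₁ a₂ x o W with hno
  set Dx := prob p (PDEvent ends a₁ a₂ x) with hDxdef
  set Q := prob p (avoidAll ends a₂ {a₁}) with hQdef
  set c := prob p (connEvent ends v x) with hcdef
  set xb := prob p (avoidAll ends a₂ {a₁} ∩ connEvent ends a₁ b) with hxb
  set yb := prob p (avoidAll ends a₂ {a₁} ∩ connEvent ends a₂ b) with hyb
  set xo := prob p (avoidAll ends a₂ {a₁} ∩ connEvent ends a₁ o) with hxo
  set yo := prob p (avoidAll ends a₂ {a₁} ∩ connEvent ends a₂ o) with hyo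
  clear_value P0 Lb F0 Lm SA nb no Dx Q c xb yb xo yo
  set D := c * Dx + (1 - c) * Q with hDdef
  clear_value D
  rcases eq_or_ne Dx 0 with hDx | hDx
  · have hnb' := hnb0 hDx
    have hno' := hno0 hDx
    rw [hDx] at hDdef ⊢
    rw [hnb', hno']
    have h1c : 1 - c ≠ 0 := by
      intro h
      apply hD
      rw [hDdef, h]
      ring
    simp only [mul_zero, add_zero, div_zero, zero_mul, zero_div, sub_zero, zero_add]
    field_simp
    rw [hDdef]
    ring
  · field_simp
    rw [hDdef]
    ring

/-- **The cut-vertex closure of (FM)**: `FMfun(v) = P(v ↔ x) · FMfun(x)` for `v` behind the cut vertex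
`x` (`P(Q) ≠ 0`). -/
theorem FMfun_cut (hp : IsProbVec p) (h : IsCut ends x ↑VA ↑VB EA EB) (ho : o ∈ insert x VB)
    (h1 : a₁ ∈ insert x VB) (h2 : a₂ ∈ insert x VB) (hb : b ∈ insert x VB) (hv : v ∈ VA) (hQ : prob p (avoidAll ends a₂ {a₁}) ≠ 0) :
    FMfun p ends o a₁ a₂ v b = prob p (connEvent ends v x) * FMfun p ends o a₁ a₂ x b := by
  have hDsplit := prob_PD_cut (p := p) h ho h1 h2 hb hv
  have hA : ∑ W : Finset V, Ssig p ends a₁ a₂ x b W =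
      prob p (avoidAll ends a₂ {a₁} ∩ connEvent ends a₁ b) -
        prob p (avoidAll ends a₂ {a₁} ∩ connEvent ends a₂ b) := by
    rw [← EQo_eq p ends b a₁ a₂ x]
    rfl
  unfold FMfun gamma0
  rw [sum_term_cut h ho h1 h2 hb hv, sum_Ssig_cut h ho h1 h2 hb hv, sum_SFg_cut h ho h1 h2 hb hv,
    sum_termA_cut h ho h1 h2 hb hv, sum_SuA_cut h ho h1 h2 hb hv (Or.inl rfl),
    sum_SuA_cut h ho h1 h2 hb hv (Or.inr rfl), hDsplit]
  rw [sum_term_SFg_affine hp ends o a₁ a₂ x b, sum_SFg_affine p ends o a₁ a₂ x, hA]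
  unfold LeafStep.mU
  set P0 := ∑ W : Finset V, Ssig p ends a₁ a₂ x b W * RootEdge.SFg p ends o a₁ a₂ x 0 W /
    mW p ends a₁ a₂ x W with hP0
  set Lb := ∑ W : Finset V, (s3 a₁ a₂ W : R) * Ssig p ends a₁ a₂ x b W with hLb
  set F0 := ∑ W : Finset V, RootEdge.SFg p ends o a₁ a₂ x 0 W with hF0
  set Lm := ∑ W : Finset V, (s3 a₁ a₂ W : R) * mW p ends a₁ a₂ x W with hLm
  set SA := ∑ W ∈ fibresA a₁ a₂, Su p ends a₁ a₂ x b W * Su p ends a₁ a₂ x o W / mW p ends a₁ a₂ x W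
    with hSA
  set nb := ∑ W ∈ fibresA a₁ a₂, Su p ends a₁ a₂ x b W with hnb
  set no := ∑ W ∈ fibresA a₁ a₂, Su p ends a₁ a₂ x o W with hno
  set Dx := prob p (PDEvent ends a₁ a₂ x) with hDxdef
  set Q := prob p (avoidAll ends a₂ {a₁}) with hQdef
  set c := prob p (connEvent ends v x) with hcdef
  set xb := prob p (avoidAll ends a₂ {a₁} ∩ connEvent ends a₁ b) with hxb
  set yb := prob p (avoidAll ends a₂ {a₁} ∩ connEvent ends a₂ b) with hyb
  set xo := prob p (avoidAll ends a₂ {a₁} ∩ connEvent ends a₁ o) with hxo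
  set yo := prob p (avoidAll ends a₂ {a₁} ∩ connEvent ends a₂ o) with hyo
  clear_value P0 Lb F0 Lm SA nb no Dx Q c xb yb xo yo
  field_simp
  ring

end Expand

/-! ## Consequences -/

section Consequences

variable {V : Type*} {E : Type*} [Fintype V] [DecidableEq V] [Fintype E] [DecidableEq E]
  {R : Type*} [Field R] [LinearOrder R] [IsStrictOrderedRing R] {ends : E → Sym2 V} {x : V}
  {VA VB : Finset V} {EA EB : Set E} [DecidablePred (· ∈ EA)] [DecidablePred (· ∈ EB)] {p : E → R}
  {o a₁ a₂ b v : V}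

/-- **(FM) behind a cut vertex from (FM) at the cut vertex.** -/
theorem FM_cut_of (hp : IsProbVec p) (h : IsCut ends x ↑VA ↑VB EA EB) (ho : o ∈ insert x VB)
    (h1 : a₁ ∈ insert x VB) (h2 : a₂ ∈ insert x VB) (hb : b ∈ insert x VB) (hv : v ∈ VA) (hx : 0 ≤ FMfun p ends o a₁ a₂ x b) :
    0 ≤ FMfun p ends o a₁ a₂ v b := by
  rcases eq_or_ne (prob p (avoidAll ends a₂ {a₁})) 0 with hQ | hQ
  · rw [FMfun_eq_zero_of_prob_Q_eq_zero' hp ends o a₁ a₂ v b hQ]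
  · rw [FMfun_cut hp h ho h1 h2 hb hv hQ]
    exact mul_nonneg (prob_nonneg hp _) hx

/-- **(MEANS-a₃) behind a cut vertex from (MEANS-a₃) ∧ (FM) at the cut vertex**: the whole mark-free
pendant part reduces to its cut vertex. -/
theorem A3Between_cut_of (hp : IsProbVec p) (h : IsCut ends x ↑VA ↑VB EA EB) (ho : o ∈ insert x VB)
    (h1 : a₁ ∈ insert x VB) (h2 : a₂ ∈ insert x VB) (hb : b ∈ insert x VB) (hv : v ∈ VA) (hxB : A3Between p ends o a₁ a₂ x b)
    (hxF : 0 ≤ FMfun p ends o a₁ a₂ x b) : A3Between p ends o a₁ a₂ v b := by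
  rcases eq_or_ne (prob p (PDEvent ends a₁ a₂ v)) 0 with hD | hD
  · exact RootEdge.A3Between_of_PD_null p hp o b hD
  · unfold A3Between
    rw [btw_cut hp h ho h1 h2 hb hv hD]
    have hc0 := prob_nonneg hp (connEvent ends v x)
    have hc1 : prob p (connEvent ends v x) ≤ 1 := by
      have := prob_mono hp (Set.subset_univ (connEvent ends v x))
      rwa [prob_univ] at this
    have hQ0 := prob_nonneg hp (avoidAll ends a₂ {a₁})
    have hDpos : 0 < prob p (PDEvent ends a₁ a₂ v) := lt_of_le_of_ne (prob_nonneg hp _) (Ne.symm hD)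
    have hs0 : 0 ≤ (1 - prob p (connEvent ends v x)) * prob p (avoidAll ends a₂ {a₁}) /
        prob p (PDEvent ends a₁ a₂ v) :=
      div_nonneg (mul_nonneg (sub_nonneg.2 hc1) hQ0) hDpos.le
    have hs1 : (1 - prob p (connEvent ends v x)) * prob p (avoidAll ends a₂ {a₁}) /
        prob p (PDEvent ends a₁ a₂ v) ≤ 1 := by
      rw [div_le_one hDpos, prob_PD_cut h ho h1 h2 hb hv]
      have hDx := prob_nonneg hp (PDEvent ends a₁ a₂ x)
      nlinarith [mul_nonneg hc0 hDx]
    unfold A3Between at hxB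
    exact mul_nonneg hc0 (add_nonneg (mul_nonneg (sub_nonneg.2 hs1) hxB) (mul_nonneg hs0 hxF))

/-- **(HCOV) behind a cut vertex from (MEANS-a₃) ∧ (FM) at the cut vertex.** -/
theorem HCov_cut_of (hp : IsProbVec p) (h : IsCut ends x ↑VA ↑VB EA EB) (ho : o ∈ insert x VB)
    (h1 : a₁ ∈ insert x VB) (h2 : a₂ ∈ insert x VB) (hb : b ∈ insert x VB) (hv : v ∈ VA) (hxB : A3Between p ends o a₁ a₂ x b)
    (hxF : 0 ≤ FMfun p ends o a₁ a₂ x b) : HCov p ends o a₁ a₂ v b :=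
  HCov_of_a3Between hp ends o a₁ a₂ v b (A3Between_cut_of hp h ho h1 h2 hb hv hxB hxF)

/-- **(FM) at every mark.** -/
theorem FM_self_mark (hp : IsProbVec p) (ends : E → Sym2 V) {o a₁ a₂ b x : V}
    (hx : x = o ∨ x = b ∨ x = a₁ ∨ x = a₂) : 0 ≤ FMfun p ends o a₁ a₂ x b := by
  rcases hx with rfl | rfl | rfl | rfl
  · exact FM_self_o hp ends _ _ _ _
  · exact FM_self_b hp ends _ _ _ _
  · exact FM_self_root hp ends _ _ _ _
  · exact FM_self_root₂ hp ends _ _ _ _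

/-- **(MEANS-a₃) at every vertex of a mark-free part hanging at a mark**: the cut vertex `x` is a mark,
the other marks are on the `B`-side, `v` is on the `A`-side. -/
theorem A3Between_pendantPart_mark (hp : IsProbVec p) (h : IsCut ends x ↑VA ↑VB EA EB)
    (hx : x = o ∨ x = b ∨ x = a₁ ∨ x = a₂) (ho : o ∈ insert x VB) (h1 : a₁ ∈ insert x VB)
    (h2 : a₂ ∈ insert x VB) (hb : b ∈ insert x VB) (hv : v ∈ VA) :
    A3Between p ends o a₁ a₂ v b :=
  A3Between_cut_of hp h ho h1 h2 hb hv (A3Between_self_mark hp ends hx) (FM_self_mark hp ends hx)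

/-- **(HCOV) at every vertex of a mark-free part hanging at a mark.** -/
theorem HCov_pendantPart_mark (hp : IsProbVec p) (h : IsCut ends x ↑VA ↑VB EA EB)
    (hx : x = o ∨ x = b ∨ x = a₁ ∨ x = a₂) (ho : o ∈ insert x VB) (h1 : a₁ ∈ insert x VB)
    (h2 : a₂ ∈ insert x VB) (hb : b ∈ insert x VB) (hv : v ∈ VA) :
    HCov p ends o a₁ a₂ v b :=
  HCov_of_a3Between hp ends o a₁ a₂ v b (A3Between_pendantPart_mark hp h hx ho h1 h2 hb hv)

/-- **(FM) at every vertex of a mark-free part hanging at a mark.** -/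
theorem FM_pendantPart_mark (hp : IsProbVec p) (h : IsCut ends x ↑VA ↑VB EA EB)
    (hx : x = o ∨ x = b ∨ x = a₁ ∨ x = a₂) (ho : o ∈ insert x VB) (h1 : a₁ ∈ insert x VB)
    (h2 : a₂ ∈ insert x VB) (hb : b ∈ insert x VB) (hv : v ∈ VA) :
    0 ≤ FMfun p ends o a₁ a₂ v b :=
  FM_cut_of hp h ho h1 h2 hb hv (FM_self_mark hp ends hx)

end Consequences

end A3Fibre

end CovForm

end Summit.Ventures.PercRepro2
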